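import Literature.AnabelianGeometry.AbsoluteAnabelian.MLFGaloisDehnTwistTransvections
import HarnessLib

/-!
# Sanity of the predicate `MLFClosure.LiftActsOnLogAs` (orientation check for the named fact `DehnTwistTransvections`)

PROOF-ONLY file (abc-iut cell, seat abc-iut-c312-1 gen 9; companion of the statement-only-lane fact
`Literature.AnabelianGeometry.AbsoluteAnabelian.DehnTwistTransvections`, K. Kondo arXiv:2512.09231 §2).  The predicate
`C.LiftActsOnLogAs p hp φ T` («THE `φ`-equivariant lift of `φ ∈ Aut_top(G_k)` acts on `k_+`, through `log_k̄` on base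
units, as `T`») is checked on the one case decidable from the tree alone:
* `MLFClosure.liftActsOnLogAs_id_of_forall_eq` — an automorphism acting as the identity on `G_k` (so THE lift is the
  identity, `AbsTopMonoids.Genuine.liftM_refl`) acts on `k_+` as `T = id`; in particular (`liftActsOnLogAs_refl_id`) the
  identity of `G_k` does — the `i`-independent part of Kondo's computation (`(φ)_+ = id` when `φ` fixes every generator).
So the predicate is inhabited in the expected orientation and is not contradictory.  Classical; no side taken on anything.
[cite: Kondo2025OuterAutMLF, §2 proof of Thm 2.3 p.10]
-/

noncomputable section

namespace Literature.AnabelianGeometry.AbsoluteAnabelian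

open Literature.IUT.HodgeArakelov ValuativeRel
open scoped ValuativeRel

namespace MLFClosure

/-- **An automorphism of `G_k` that is (pointwise) the identity acts on `k_+` as the identity**: THE lift is then the
identity of `𝒪_k̄^⊳` (`Genuine.liftM_refl`), so `u' = u`, hence `log u' = log u` and `t' = t` (`k → k̄` is injective).
[cite: Kondo2025OuterAutMLF, §2 proof of Thm 2.3 p.10] -/
theorem liftActsOnLogAs_id_of_forall_eq (C : MLFClosure.{0}) (p : ℕ) [Fact p.Prime] (hp : valuation C.k p < 1)
    {φ : (ModelMLFGaloisData.galois C.k C.K).tmPair.Pi ≃ₜ* (ModelMLFGaloisData.galois C.k C.K).tmPair.Pi}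
    (hφ : ∀ σ, φ σ = σ) : C.LiftActsOnLogAs p hp φ id := by
  intro x x' u u' t t' hx hx' hlift ht ht'
  rw [AbsTopMonoids.Genuine.liftM_refl C hφ, MulEquiv.refl_apply] at hlift
  subst hlift
  have huu' : u = u' := (algebraMap C.k C.K).injective (hx.symm.trans hx')
  subst huu'
  exact ((algebraMap C.k C.K).injective (ht'.symm.trans ht)).symm ▸ rfl

/-- In particular the identity of `G_k` acts on `k_+` as the identity. [cite: Kondo2025OuterAutMLF, §2 proof of Thm 2.3 p.10] -/
theorem liftActsOnLogAs_refl_id (C : MLFClosure.{0}) (p : ℕ) [Fact p.Prime] (hp : valuation C.k p < 1) :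
    C.LiftActsOnLogAs p hp (ContinuousMulEquiv.refl _) id :=
  C.liftActsOnLogAs_id_of_forall_eq p hp fun _ => rfl

end MLFClosure

end Literature.AnabelianGeometry.AbsoluteAnabelian

end
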